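import Summits.HubbardSuperconductivity.HubbardSuperconductivity.Theorems.AnisotropyChordTransferFibre3KernelDiff2Sum
import Summits.HubbardSuperconductivity.HubbardSuperconductivity.Theorems.AnisotropyChordTransferFibre3ChainLimit
import Mathlib.NumberTheory.Harmonic.Bounds

/-!
# Route `AnisotropyChord` / H0 rotor rung: ★ the SHARP PERIODISATION RATE `|a^{(L)}_0(r) − a_∞(r)| ≤ C·|r|²(1 + ln L)/L²` — second-order Abel summation

Tenth file of the periodisation toolkit (memo ROTOR-THEORY-21 §320–§322; true law `|r|²/(4V)`).  Same architecture as
`…DyadicStep`/`…DyadicRate` (coset identity, three alternating sums at the half-period points, dyadic telescoping, the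
modulus-independent limit `aZ2` of `…ChainLimit`), but the alternating sums are summed by parts TWICE
(`abs_alternating_sum_le_d2`: `|Σ σF| ≤ ¼ Σ|Δ²F|`) and controlled by the logarithmic second-difference functional of
`…KernelDiff2Sum`:
* `alternating_sum_eq_half`, ★ `abs_alternating_sum_le_d2`, `abs_aKer_half_shift_le_d2`, `sum_abs_hfun_d2_ey_eq` (swap symmetry);
* ★★ `abs_aKer_red_sub_le_d2` / `abs_aKer_sub_aKer_double_le_sharp`: `|a^{(M)}_0(x,y) − a^{(2M)}_0(x,y)| ≤ 3(8K₂H_M + 3π²)ρ/(16M²)`;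
* telescoping with `H_{2^k M} ≤ 1 + ln M + k ln 2` and `(A + Bk) ≤ (A + B)2^k`: `aDyad_dist_le_sharp`,
  ★★★ `abs_aKer_sub_aZ2_le_sharp`: for EVERY `L ≥ 1`, `|a^{(L)}_0(x,y) − aZ2 x y| ≤ 3(8K₂(1 + ln 2 + ln L) + 3π²)(x² + y²)/(8L²)`,
  `K₂ = π²/2 + 53π⁴/8 + 6π⁶` — the SAME limit kernel `aZ2` (identification `aInf_eq_aZ2`), rate now `O(|r|² ln L/L²)`.
Prover seat `hubbard-h0-rotor-p2` g2; helper for stmt-19089. WHAT THIS IS NOT: nothing here proves superconductivity in the Hubbard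
model (rotor TARGET stays FALSE, g15); a convergence rate for ONE input (periodisation) of HOLE₂ of rung 19089. No sorry, no axioms.
-/

set_option linter.dupNamespace false

noncomputable section

open scoped BigOperators
open Complex Finset

namespace Summit.HubbardSuperconductivity.HubbardSuperconductivity.Theorems.AnisotropyChord.Transfer.Fibre3

namespace Subsample

/-! ## Second-order Abel summation for sign-alternating weights -/

/-- one Abel step: `Σ σF = ½ Σ σ(n)(F(n) − F(n + d))` when `σ(n + d) = −σ(n)`. [folklore] -/
theorem alternating_sum_eq_half {L : ℕ} [NeZero L] (σ F : Tor L → ℝ) (d : Tor L) (hσ : ∀ n, σ (n + d) = -σ n) :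
    ∑ n : Tor L, σ n * F n = (1 / 2) * ∑ n : Tor L, σ n * (F n - F (n + d)) := by
  have hshift : ∑ n : Tor L, σ n * F n = ∑ n : Tor L, σ (n + d) * F (n + d) :=
    (Equiv.sum_comp (Equiv.addRight d) (fun n => σ n * F n)).symm
  have h2 : ∑ n : Tor L, σ (n + d) * F (n + d) = -∑ n : Tor L, σ n * F (n + d) := by
    rw [← Finset.sum_neg_distrib]
    refine Finset.sum_congr rfl fun n _ => ?_
    rw [hσ]; ring
  have h3 : ∑ n : Tor L, σ n * (F n - F (n + d)) = ∑ n : Tor L, σ n * F n - ∑ n : Tor L, σ n * F (n + d) := by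
    rw [← Finset.sum_sub_distrib]
    refine Finset.sum_congr rfl fun n _ => ?_
    ring
  rw [h3]
  linarith

/-- ★ DOUBLE Abel summation: `|Σ σF| ≤ ¼ Σ_n |F(n + 2d) − 2F(n + d) + F(n)|` when `σ(n + d) = −σ(n)`, `|σ| ≤ 1`. [folklore] -/
theorem abs_alternating_sum_le_d2 {L : ℕ} [NeZero L] (σ F : Tor L → ℝ) (d : Tor L) (hσ : ∀ n, σ (n + d) = -σ n)
    (hσ1 : ∀ n, |σ n| ≤ 1) :
    |∑ n : Tor L, σ n * F n| ≤ (1 / 4) * ∑ n : Tor L, |F (n + d + d) - 2 * F (n + d) + F n| := by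
  rw [alternating_sum_eq_half σ F d hσ, alternating_sum_eq_half σ (fun n => F n - F (n + d)) d hσ]
  have e : ∀ n : Tor L, (F n - F (n + d)) - (F (n + d) - F (n + d + d)) = F (n + d + d) - 2 * F (n + d) + F n := by
    intro n; ring
  simp only [e]
  rw [← mul_assoc, abs_mul, show |(1 / 2 : ℝ) * (1 / 2)| = 1 / 4 by norm_num]
  refine mul_le_mul_of_nonneg_left ((Finset.abs_sum_le_sum_abs _ _).trans (Finset.sum_le_sum fun n _ => ?_))
    (by norm_num)
  rw [abs_mul]
  calc |σ n| * |F (n + d + d) - 2 * F (n + d) + F n| ≤ 1 * |F (n + d + d) - 2 * F (n + d) + F n| :=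
        mul_le_mul_of_nonneg_right (hσ1 n) (abs_nonneg _)
    _ = _ := one_mul _

/-- ★ the kernel increment at a half-period point via SECOND differences (`λ = 0`):
`|a(r + c) − a(c)| ≤ (1/(4V)) Σ_n |h_r(n + 2d) − 2h_r(n + d) + h_r(n)|` for any `d` with `φ_d(c) = −1`. [folklore] -/
theorem abs_aKer_half_shift_le_d2 {L : ℕ} [NeZero L] {c d : Tor L} (hc : c + c = 0) (hd : phase L d c = -1) (r : Tor L) :
    |aKer L 0 (r + c) - aKer L 0 c|
      ≤ (∑ n : Tor L, |hfun L r (n + d + d) - 2 * hfun L r (n + d) + hfun L r n|) / (4 * (L : ℝ) ^ 2) := by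
  have hV : (0 : ℝ) < (L : ℝ) ^ 2 := by
    have : (0 : ℝ) < (L : ℝ) := by exact_mod_cast Nat.pos_of_ne_zero (NeZero.ne L)
    positivity
  rw [aKer_half_shift L hc, abs_div, abs_of_pos hV]
  have h := abs_alternating_sum_le_d2 (fun n => (phase L n c).re) (fun n => hfun L r n) d (re_phase_shift_neg L hd)
    (fun n => abs_re_phase_le L n c)
  calc |∑ n : Tor L, (phase L n c).re * (gres L 0 n * (1 - (phase L n r).re))| / (L : ℝ) ^ 2
      ≤ ((1 / 4 : ℝ) * ∑ n : Tor L, |hfun L r (n + d + d) - 2 * hfun L r (n + d) + hfun L r n|) / (L : ℝ) ^ 2 :=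
        div_le_div_of_nonneg_right h hV.le
    _ = _ := by field_simp

/-- swap symmetry of the second-difference functional: `T₂_{e_y}((x,y)) = T₂_{eₓ}((y,x))` on any torus. [folklore] -/
theorem sum_abs_hfun_d2_ey_eq (L : ℕ) [NeZero L] (x y : ℤ) :
    ∑ n : Tor L, |hfun L (((x : ℤ) : ZMod L), ((y : ℤ) : ZMod L)) (n + ey L + ey L)
        - 2 * hfun L (((x : ℤ) : ZMod L), ((y : ℤ) : ZMod L)) (n + ey L)
        + hfun L (((x : ℤ) : ZMod L), ((y : ℤ) : ZMod L)) n|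
      = ∑ n : Tor L, |hfun L (((y : ℤ) : ZMod L), ((x : ℤ) : ZMod L)) (n + ex L + ex L)
          - 2 * hfun L (((y : ℤ) : ZMod L), ((x : ℤ) : ZMod L)) (n + ex L)
          + hfun L (((y : ℤ) : ZMod L), ((x : ℤ) : ZMod L)) n| := by
  rw [← Equiv.sum_comp (Equiv.prodComm (ZMod L) (ZMod L))]
  refine Finset.sum_congr rfl fun n _ => ?_
  simp only [Equiv.prodComm_apply, Prod.swap]
  have hsw : ∀ m : Tor L, hfun L (((x : ℤ) : ZMod L), ((y : ℤ) : ZMod L)) (m.2, m.1)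
      = hfun L (((y : ℤ) : ZMod L), ((x : ℤ) : ZMod L)) m := by
    intro m
    unfold hfun gres
    rw [epsT_swap]
    have hp : phase L (m.2, m.1) (((x : ℤ) : ZMod L), ((y : ℤ) : ZMod L))
        = phase L m (((y : ℤ) : ZMod L), ((x : ℤ) : ZMod L)) :=
      phase_swap_swap L m (((y : ℤ) : ZMod L), ((x : ℤ) : ZMod L))
    rw [hp]
    have h0 : ((m.2, m.1) = (0 : Tor L)) ↔ (m = 0) := by
      constructor
      · intro h; ext <;> simp_all [Prod.ext_iff]
      · intro h; simp [h]
    simp only [h0]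
  have e1 : ((n.2, n.1) : Tor L) + ey L = ((n + ex L).2, (n + ex L).1) := by
    ext <;> simp [ex, ey]
  have e2 : ((n.2, n.1) : Tor L) + ey L + ey L = ((n + ex L + ex L).2, (n + ex L + ex L).1) := by
    ext <;> simp [ex, ey]
  rw [e2, e1, hsw, hsw, hsw]

/-! ## The sharp dyadic step -/

section Dyadic2

variable (M : ℕ) [NeZero M]

/-- ★★ **THE SHARP DYADIC STEP** (`λ = 0`): `|a^{(M)}_0(x,y) − a^{(2M)}_0(x,y)| ≤ 3(8K₂·H_M + 3π²)(x² + y²)/(16M²)`. [folklore] -/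
theorem abs_aKer_sub_aKer_double_le_sharp (x y : ℤ) :
    |aKer M 0 (((x : ℤ) : ZMod M), ((y : ℤ) : ZMod M))
        - aKer (2 * M) 0 (((x : ℤ) : ZMod (2 * M)), ((y : ℤ) : ZMod (2 * M)))|
      ≤ 3 * (8 * (Real.pi ^ 2 / 2 + 53 * Real.pi ^ 4 / 8 + 6 * Real.pi ^ 6) * (harmonic M : ℝ) + 3 * Real.pi ^ 2)
          * ((x : ℝ) ^ 2 + (y : ℝ) ^ 2) / (16 * (M : ℝ) ^ 2) := by
  set r : Tor (2 * M) := (((x : ℤ) : ZMod (2 * M)), ((y : ℤ) : ZMod (2 * M))) with hr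
  have hred := red_intCast M 2 x y
  have hsub := aKer_subsample M 2 0 r
  rw [hred] at hsub
  rw [sum_tor_two] at hsub
  obtain ⟨j00, j01, j10, j11⟩ := jshift_two M
  rw [j00, j01, j10, j11, show ((0 : ZMod (2 * M)), (0 : ZMod (2 * M))) = (0 : Tor (2 * M)) from rfl, add_zero,
    aKer_zero', sub_zero] at hsub
  have hc1 : ((((M : ℕ) : ZMod (2 * M)), (0 : ZMod (2 * M))) : Tor (2 * M)) + (((M : ℕ) : ZMod (2 * M)), 0) = 0 := by
    ext <;> simp [half_add_half]
  have hc2 : (((0 : ZMod (2 * M)), ((M : ℕ) : ZMod (2 * M))) : Tor (2 * M)) + (0, ((M : ℕ) : ZMod (2 * M))) = 0 := by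
    ext <;> simp [half_add_half]
  have hc3 : ((((M : ℕ) : ZMod (2 * M)), ((M : ℕ) : ZMod (2 * M))) : Tor (2 * M))
      + (((M : ℕ) : ZMod (2 * M)), ((M : ℕ) : ZMod (2 * M))) = 0 := by
    ext <;> simp [half_add_half]
  have b1 := abs_aKer_half_shift_le_d2 hc1 (phase_ex_half M 0) r
  have b2 := abs_aKer_half_shift_le_d2 hc2 (phase_ey_half M 0) r
  have b3 := abs_aKer_half_shift_le_d2 hc3 (phase_ex_half M _) r
  -- the two functionals
  set K2 := Real.pi ^ 2 / 2 + 53 * Real.pi ^ 4 / 8 + 6 * Real.pi ^ 6 with hK2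
  set ρ := (x : ℝ) ^ 2 + (y : ℝ) ^ 2 with hρ
  have hH : (harmonic (2 * M / 2) : ℝ) = harmonic M := by
    rw [Nat.mul_div_cancel_left M two_pos]
  have hTx : ∑ n : Tor (2 * M), |hfun (2 * M) r (n + ex (2 * M) + ex (2 * M)) - 2 * hfun (2 * M) r (n + ex (2 * M))
      + hfun (2 * M) r n| ≤ (8 * K2 * (harmonic M : ℝ) + 3 * Real.pi ^ 2) * ρ := by
    have h := sum_abs_hfun_d2_le (2 * M) x y
    rw [hH] at h
    rw [hr]; exact h
  have hTy : ∑ n : Tor (2 * M), |hfun (2 * M) r (n + ey (2 * M) + ey (2 * M)) - 2 * hfun (2 * M) r (n + ey (2 * M))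
      + hfun (2 * M) r n| ≤ (8 * K2 * (harmonic M : ℝ) + 3 * Real.pi ^ 2) * ρ := by
    rw [hr, sum_abs_hfun_d2_ey_eq]
    have h := sum_abs_hfun_d2_le (2 * M) y x
    rw [hH] at h
    have e : ((y : ℝ) ^ 2 + (x : ℝ) ^ 2) = ρ := by rw [hρ]; ring
    rw [e] at h
    exact h
  have heq : aKer M 0 (((x : ℤ) : ZMod M), ((y : ℤ) : ZMod M)) - aKer (2 * M) 0 r
      = (aKer (2 * M) 0 (r + (0, ((M : ℕ) : ZMod (2 * M)))) - aKer (2 * M) 0 (0, ((M : ℕ) : ZMod (2 * M))))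
        + (aKer (2 * M) 0 (r + (((M : ℕ) : ZMod (2 * M)), 0)) - aKer (2 * M) 0 (((M : ℕ) : ZMod (2 * M)), 0))
        + (aKer (2 * M) 0 (r + (((M : ℕ) : ZMod (2 * M)), ((M : ℕ) : ZMod (2 * M))))
            - aKer (2 * M) 0 (((M : ℕ) : ZMod (2 * M)), ((M : ℕ) : ZMod (2 * M)))) := by
    rw [hsub]; ring
  rw [heq]
  have hM : (0 : ℝ) < M := by exact_mod_cast Nat.pos_of_ne_zero (NeZero.ne M)
  have hN : ((2 * M : ℕ) : ℝ) = 2 * (M : ℝ) := by push_cast; ring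
  rw [hN] at b1 b2 b3
  calc _ ≤ |aKer (2 * M) 0 (r + (0, ((M : ℕ) : ZMod (2 * M)))) - aKer (2 * M) 0 (0, ((M : ℕ) : ZMod (2 * M)))|
        + |aKer (2 * M) 0 (r + (((M : ℕ) : ZMod (2 * M)), 0)) - aKer (2 * M) 0 (((M : ℕ) : ZMod (2 * M)), 0)|
        + |aKer (2 * M) 0 (r + (((M : ℕ) : ZMod (2 * M)), ((M : ℕ) : ZMod (2 * M))))
            - aKer (2 * M) 0 (((M : ℕ) : ZMod (2 * M)), ((M : ℕ) : ZMod (2 * M)))| :=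
          (abs_add_le _ _).trans (by gcongr; exact abs_add_le _ _)
    _ ≤ (8 * K2 * (harmonic M : ℝ) + 3 * Real.pi ^ 2) * ρ / (4 * (2 * (M : ℝ)) ^ 2)
        + (8 * K2 * (harmonic M : ℝ) + 3 * Real.pi ^ 2) * ρ / (4 * (2 * (M : ℝ)) ^ 2)
        + (8 * K2 * (harmonic M : ℝ) + 3 * Real.pi ^ 2) * ρ / (4 * (2 * (M : ℝ)) ^ 2) := by
          refine add_le_add (add_le_add (b2.trans ?_) (b1.trans ?_)) (b3.trans ?_)
          · exact div_le_div_of_nonneg_right hTy (by positivity)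
          · exact div_le_div_of_nonneg_right hTx (by positivity)
          · exact div_le_div_of_nonneg_right hTx (by positivity)
    _ = _ := by
          field_simp
          ring

end Dyadic2

/-! ## Telescoping: the sharp rate to the limit kernel `aZ2` -/

section Sharp

open Filter Topology

variable (M : ℕ) [NeZero M]

/-- the sharp double-modulus comparison with the fine modulus as a parameter. [folklore] -/
theorem abs_aKer_sub_aKer_of_eq_double_sharp {M' N' : ℕ} [NeZero M'] [NeZero N'] (h : N' = 2 * M') (x y : ℤ) :
    |aKer M' 0 (((x : ℤ) : ZMod M'), ((y : ℤ) : ZMod M')) - aKer N' 0 (((x : ℤ) : ZMod N'), ((y : ℤ) : ZMod N'))|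
      ≤ 3 * (8 * (Real.pi ^ 2 / 2 + 53 * Real.pi ^ 4 / 8 + 6 * Real.pi ^ 6) * (harmonic M' : ℝ) + 3 * Real.pi ^ 2)
          * ((x : ℝ) ^ 2 + (y : ℝ) ^ 2) / (16 * (M' : ℝ) ^ 2) := by
  subst h
  exact abs_aKer_sub_aKer_double_le_sharp M' x y

/-- `H_n ≤ 1 + ln n` in the form needed along the chain: `H_{2^k M} ≤ 1 + ln M + k·ln 2`. [folklore] -/
theorem harmonic_dyadic_le (k : ℕ) : (harmonic (2 ^ k * M) : ℝ) ≤ 1 + Real.log M + k * Real.log 2 := by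
  have h := harmonic_le_one_add_log (2 ^ k * M)
  have hM : (0 : ℝ) < M := by exact_mod_cast Nat.pos_of_ne_zero (NeZero.ne M)
  have e : Real.log ((2 ^ k * M : ℕ) : ℝ) = k * Real.log 2 + Real.log M := by
    push_cast
    rw [Real.log_mul (by positivity) hM.ne', Real.log_pow]
  rw [e] at h
  linarith

/-- the sharp dyadic step in geometric form: `dist(a_k, a_{k+1}) ≤ C_M·ρ·(1/2)^k` with
`C_M = 3(8K₂(1 + ln M + ln 2) + 3π²)/(16M²)`. [folklore] -/
theorem aDyad_dist_le_sharp (x y : ℤ) (k : ℕ) :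
    dist (aDyad M x y k) (aDyad M x y (k + 1))
      ≤ 3 * (8 * (Real.pi ^ 2 / 2 + 53 * Real.pi ^ 4 / 8 + 6 * Real.pi ^ 6) * (1 + Real.log M + Real.log 2)
            + 3 * Real.pi ^ 2) * ((x : ℝ) ^ 2 + (y : ℝ) ^ 2) / (16 * (M : ℝ) ^ 2) * (1 / 2 : ℝ) ^ k := by
  have h2k : 2 ^ (k + 1) * M = 2 * (2 ^ k * M) := by ring
  have hb := abs_aKer_sub_aKer_of_eq_double_sharp (M' := 2 ^ k * M) (N' := 2 ^ (k + 1) * M) h2k x y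
  rw [Real.dist_eq]
  unfold aDyad
  refine hb.trans ?_
  have hM : (0 : ℝ) < M := by exact_mod_cast Nat.pos_of_ne_zero (NeZero.ne M)
  have hM1 : (1 : ℝ) ≤ M := by exact_mod_cast Nat.pos_of_ne_zero (NeZero.ne M)
  set K2 := Real.pi ^ 2 / 2 + 53 * Real.pi ^ 4 / 8 + 6 * Real.pi ^ 6 with hK2
  set ρ := (x : ℝ) ^ 2 + (y : ℝ) ^ 2 with hρ
  have hK0 : 0 ≤ K2 := by rw [hK2]; positivity
  have hρ0 : 0 ≤ ρ := by rw [hρ]; positivity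
  have hH := harmonic_dyadic_le M k
  have hlogM : 0 ≤ Real.log M := Real.log_nonneg hM1
  have hlog2 : 0 ≤ Real.log 2 := Real.log_nonneg (by norm_num)
  -- `A + Bk ≤ (A + B)·2^k`
  have h2k : (k : ℝ) ≤ (2 : ℝ) ^ k := by
    have := Nat.lt_two_pow_self (n := k)
    exact_mod_cast this.le
  have h1k : (1 : ℝ) ≤ (2 : ℝ) ^ k := one_le_pow₀ (by norm_num)
  have hnum : 8 * K2 * (harmonic (2 ^ k * M) : ℝ) + 3 * Real.pi ^ 2
      ≤ (8 * K2 * (1 + Real.log M + Real.log 2) + 3 * Real.pi ^ 2) * (2 : ℝ) ^ k := by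
    have e1 : 8 * K2 * (harmonic (2 ^ k * M) : ℝ) ≤ 8 * K2 * (1 + Real.log M + k * Real.log 2) :=
      mul_le_mul_of_nonneg_left hH (by positivity)
    have e2 : (k : ℝ) * Real.log 2 ≤ (2 : ℝ) ^ k * Real.log 2 := mul_le_mul_of_nonneg_right h2k hlog2
    have e3 : (1 + Real.log M) ≤ (1 + Real.log M) * (2 : ℝ) ^ k := le_mul_of_one_le_right (by positivity) h1k
    have e4 : 3 * Real.pi ^ 2 ≤ 3 * Real.pi ^ 2 * (2 : ℝ) ^ k := le_mul_of_one_le_right (by positivity) h1k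
    nlinarith
  have hcast : ((2 ^ k * M : ℕ) : ℝ) = (2 : ℝ) ^ k * M := by push_cast; ring
  rw [hcast]
  have hpow : (0 : ℝ) < (2 : ℝ) ^ k := by positivity
  calc 3 * (8 * K2 * (harmonic (2 ^ k * M) : ℝ) + 3 * Real.pi ^ 2) * ρ / (16 * ((2 : ℝ) ^ k * M) ^ 2)
      ≤ 3 * ((8 * K2 * (1 + Real.log M + Real.log 2) + 3 * Real.pi ^ 2) * (2 : ℝ) ^ k) * ρ
          / (16 * ((2 : ℝ) ^ k * M) ^ 2) := by gcongr
    _ = _ := by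
          rw [one_div_pow]
          field_simp

/-- ★★★ **THE SHARP PERIODISATION RATE, UNIFORM IN THE MODULUS** (`λ = 0`): for EVERY `L ≥ 1` and every integer separation,
`|a^{(L)}_0(x,y) − a_∞(x,y)| ≤ 3(8K₂(1 + ln 2 + ln L) + 3π²)·(x² + y²)/(8L²)` with the SAME modulus-independent kernel
`a_∞ = aZ2` as `abs_aKer_sub_aZ2_le` (rate now `O(|r|² ln L/L²)`; true law `|r|²/(4V)`). [folklore] -/
theorem abs_aKer_sub_aZ2_le_sharp (L : ℕ) [NeZero L] (x y : ℤ) :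
    |aKer L 0 (((x : ℤ) : ZMod L), ((y : ℤ) : ZMod L)) - aZ2 x y|
      ≤ 3 * (8 * (Real.pi ^ 2 / 2 + 53 * Real.pi ^ 4 / 8 + 6 * Real.pi ^ 6) * (1 + Real.log 2 + Real.log L)
            + 3 * Real.pi ^ 2) * ((x : ℝ) ^ 2 + (y : ℝ) ^ 2) / (8 * (L : ℝ) ^ 2) := by
  have h := dist_le_of_le_geometric_of_tendsto (1 / 2 : ℝ) _ (by norm_num) (aDyad_dist_le_sharp L x y)
    (aDyad_tendsto L x y) 0
  rw [Real.dist_eq] at h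
  have e : aDyad L x y 0 = aKer L 0 (((x : ℤ) : ZMod L), ((y : ℤ) : ZMod L)) := by
    unfold aDyad
    exact aKer_intCast_congr (by ring) 0 x y
  rw [e, aInf_eq_aZ2, pow_zero, mul_one] at h
  refine h.trans (le_of_eq ?_)
  have hL : (L : ℝ) ≠ 0 := by exact_mod_cast (NeZero.ne L)
  field_simp
  ring

end Sharp

end Subsample

end Summit.HubbardSuperconductivity.HubbardSuperconductivity.Theorems.AnisotropyChord.Transfer.Fibre3

end
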